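import Summits.QuantumFields.YangMills.Theorems.SwapTwistDeficitToronLog
import Summits.QuantumFields.YangMills.Theorems.SwapTwistDeficitToronFloorAction
import Summits.QuantumFields.YangMills.Theorems.VirialFluxGapTreeGaugeGibbsTransfer
import Summits.QuantumFields.YangMills.Theorems.VirialFluxGapRegularityCutoff
import Literature.MathematicalPhysics.QuantumLattice.SU2HaarSmallBall
import HarnessLib

/-!
# The periodic toron log-floor, II: chordal balls, the four letters, the toron event on the tree-gauged ring space

Brick (A) of the seat memo `SWAP-STRATA-23802-w2g54.md` (evidence #2 on ⟨stmt-QuantumFields-23802⟩), MEASURE half, first file.  On the tree-gauged ring space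
`X_fix = SU(2)^{off-tree} × (GaugeConfig 3 L SU(2))^{2L−1} × SU(2)^{sites}` with its product Haar measure `μ_fix` (✓`TreeGaugeTransfer`), the TORON EVENT
`toronEvent t τ`: the three wrap letters `h_k = w(wrapEdge k)` and the seam letter `C = g 0` pairwise almost commute (`∈ nearlyCommuting t` of
✓`SwapTwistDeficitToronLog`), every off-tree link of slice `0` and every link of the slices `1…2L−1` is within `τ` (chordal distance ✓`fd`) of the
comb-flat pattern ✓`combFlat h`, and every seam value is within `τ` of `C`.
* §1 chordal balls `{u | fd u c ≤ τ}`: measurability (through ✓`measurable_su2Quat`), left-translation invariance of their Haar mass `fdBallMass τ`, and the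
  SHARP small-ball floor `fdBallMass_ge`: `Haar{fd u 1 ≤ τ} ≥ (2/π²)·τ³/256` (cone measure of a coordinate box, ✓`ToronLog.volume_quatBox` / ✓`coneMeasure_apply`);
* §2 the wrap indices (`wrapEdge k` is off-tree), `wrapLetters`, `letters`;
* §3 the event `toronEvent` and its measurability;
* §4 products of chordal balls (`pi_haar_fdBalls`, `pi_config_fdBalls`) and the seam factor `gaugeMeasure_seam` (origin letter free in a set `A`, the other
  values in the ball around it: mass `b(τ)^{|sites|−1}·Haar(A)`, via `piEquivPiSubtypeProd` at the origin).
HONEST LABEL: measure-theoretic bookkeeping; nothing about ⟨23802⟩/⟨24196⟩ or any rung is proved; the Yang–Mills mass gap is NOT proved; no summit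
is proved by a line.  Width seat ym-line-sfw-p2-w2 g54 (cell ym-idea-1, free hands; `--supports stmt-QuantumFields-23802`).  Definitions + theorems,
0 `sorry`, standard axioms.  References: [cite: Luscher1983, §2]; [cite: Vanbaal2001]; [folklore].
-/

set_option autoImplicit false

noncomputable section

open MeasureTheory Set
open scoped BigOperators ENNReal Quaternion
open Literature.MathematicalPhysics.QuantumFieldTheory hiding SU2
open Literature.MathematicalPhysics.QuantumLattice
open Summit.QuantumFields.YangMills.Theorems.FemtoTransferGap
open Summit.QuantumFields.YangMills.Theorems.FemtoTransferGap.TT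
open Summit.QuantumFields.YangMills.Theorems.FemtoTransferGap.TwoLattice.Flat
open Summit.QuantumFields.YangMills.Theorems.VirialFluxGap
open Summit.QuantumFields.YangMills.Theorems.VirialFluxGap.RegCutoff (wrapEdge)

attribute [local instance] Literature.Analysis.FluidPDE.Tao2016.quatMeasurableSpace
  Literature.Analysis.FluidPDE.Tao2016.quatBorelSpace
  Literature.MathematicalPhysics.QuantumLattice.secondCountableTopology_su2

namespace Summit.QuantumFields.YangMills.Theorems.SwapTwistDeficit.ToronFloor

-- one `Fintype` instance on the subtypes `{y // y = 0}` (the generic `Subtype.fintype`), so that product measures over them agree syntactically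
attribute [-instance] Fintype.subtypeEq

variable {L : ℕ} [NeZero L]

/-! ## §1 Chordal balls in `SU(2)` -/

omit [NeZero L] in
/-- The chordal ball condition through unit quaternions: `fd u c ≤ τ ↔ 0 ≤ τ ∧ 2‖q(u) − q(c)‖² ≤ τ²`. [folklore] -/
theorem fd_le_iff (u c : SU2) (τ : ℝ) : fd u c ≤ τ ↔ 0 ≤ τ ∧ 2 * ‖su2Quat u - su2Quat c‖ ^ 2 ≤ τ ^ 2 := by
  have h := OwnAxis.norm_su2Quat_sub_sq_eq u c
  have h0 : 0 ≤ fd u c := frobNorm_nonneg _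
  have hfd : fd u c ^ 2 = 2 * ‖su2Quat u - su2Quat c‖ ^ 2 := by unfold fd; linarith
  constructor
  · intro hle
    exact ⟨h0.trans hle, by rw [← hfd]; exact pow_le_pow_left₀ h0 hle 2⟩
  · rintro ⟨hτ, h2⟩
    rw [← hfd] at h2
    exact (pow_le_pow_iff_left₀ h0 hτ two_ne_zero).1 h2

omit [NeZero L] in
/-- Measurability of chordal-ball conditions `fd (f x) (g x) ≤ τ` for measurable `f, g` (via the measurable unit-quaternion map). [folklore] -/
theorem measurableSet_fd_le {X : Type*} [MeasurableSpace X] {f g : X → SU2} (hf : Measurable f) (hg : Measurable g) (τ : ℝ) :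
    MeasurableSet {x : X | fd (f x) (g x) ≤ τ} := by
  have hq := Literature.MathematicalPhysics.QuantumFieldTheory.Balaban1983to89.T4HaarSU2Translate.measurable_su2Quat
  have hm : Measurable fun x : X => 2 * ‖su2Quat (f x) - su2Quat (g x)‖ ^ 2 :=
    (((hq.comp hf).sub (hq.comp hg)).norm.pow_const 2).const_mul 2
  have e : {x : X | fd (f x) (g x) ≤ τ} = {x : X | 0 ≤ τ} ∩ {x : X | 2 * ‖su2Quat (f x) - su2Quat (g x)‖ ^ 2 ≤ τ ^ 2} := by
    ext x; simp only [Set.mem_setOf_eq, Set.mem_inter_iff, fd_le_iff]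
  rw [e]
  exact (MeasurableSet.const _).inter (measurableSet_le hm measurable_const)

omit [NeZero L] in
/-- Chordal balls are measurable. [folklore] -/
theorem measurableSet_fdBall (c : SU2) (τ : ℝ) : MeasurableSet {u : SU2 | fd u c ≤ τ} :=
  measurableSet_fd_le measurable_id measurable_const τ

/-- The Haar mass of the chordal ball of radius `τ` (around `1`, hence around any centre). [folklore] -/
def fdBallMass (τ : ℝ) : ℝ≥0∞ := haarProbability SU2 {u : SU2 | fd u 1 ≤ τ}

omit [NeZero L] in
/-- **Left-translation invariance**: the chordal ball around `c` has the Haar mass of the ball around `1`. [folklore] -/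
theorem haar_fdBall_eq (c : SU2) (τ : ℝ) : haarProbability SU2 {u : SU2 | fd u c ≤ τ} = fdBallMass τ := by
  haveI : (haarProbability SU2).IsMulLeftInvariant := by
    rw [haarProbability_su2_eq_su2BallMeasure]; infer_instance
  have e : {u : SU2 | fd u c ≤ τ} = (fun u => c⁻¹ * u) ⁻¹' {u : SU2 | fd u 1 ≤ τ} := by
    ext u
    simp only [Set.mem_setOf_eq, Set.mem_preimage]
    rw [← fd_mul_left c⁻¹ u c, inv_mul_cancel]
  rw [fdBallMass, e, measure_preimage_mul]

omit [NeZero L] in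
/-- **Sharp small-ball floor**: `Haar{u | fd u 1 ≤ τ} ≥ (2/π²)·τ³/256` for `0 < τ ≤ 1` (the radial projection of the coordinate box
`re ∈ [½,¾]`, `|im_•| ≤ τ/8` of `ℍ` lies in the ball). [folklore] -/
theorem fdBallMass_ge {τ : ℝ} (hτ0 : 0 < τ) (hτ1 : τ ≤ 1) :
    ENNReal.ofReal (ToronLog.coneConst * (τ ^ 3 / 256)) ≤ fdBallMass τ := by
  haveI := ToronLog.isProbabilityMeasure_coneMeasure
  -- the coordinate box
  set lo : Fin 4 → ℝ := ![1 / 2, -(τ / 8), -(τ / 8), -(τ / 8)] with hlo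
  set hi : Fin 4 → ℝ := ![3 / 4, τ / 8, τ / 8, τ / 8] with hhi
  have hbox_ball : ToronLog.quatBox lo hi ⊆ Metric.ball (0 : ℍ) 1 := by
    intro x hx
    simp only [ToronLog.quatBox, hlo, hhi, Set.mem_setOf_eq, Matrix.cons_val_zero, Matrix.cons_val_one, Matrix.cons_val] at hx
    obtain ⟨h1, h2, h3, h4, h5, h6, h7, h8⟩ := hx
    rw [Metric.mem_ball, dist_zero_right]
    have hsq := sq_norm_eq_sum_sq x
    have hI : x.imI ^ 2 ≤ (τ / 8) ^ 2 := sq_le_sq' h3 h4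
    have hJ : x.imJ ^ 2 ≤ (τ / 8) ^ 2 := sq_le_sq' h5 h6
    have hK : x.imK ^ 2 ≤ (τ / 8) ^ 2 := sq_le_sq' h7 h8
    nlinarith [norm_nonneg x]
  -- the box projects into the chordal ball
  have hproj : ToronLog.quatBox lo hi ⊆ quatToSU2 ⁻¹' {u : SU2 | fd u 1 ≤ τ} := by
    intro x hx
    simp only [ToronLog.quatBox, hlo, hhi, Set.mem_setOf_eq, Matrix.cons_val_zero, Matrix.cons_val_one, Matrix.cons_val] at hx
    obtain ⟨h1, h2, h3, h4, h5, h6, h7, h8⟩ := hx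
    rw [Set.mem_preimage, Set.mem_setOf_eq]
    have hsq := sq_norm_eq_sum_sq x
    have hI : x.imI ^ 2 ≤ (τ / 8) ^ 2 := sq_le_sq' h3 h4
    have hJ : x.imJ ^ 2 ≤ (τ / 8) ^ 2 := sq_le_sq' h5 h6
    have hK : x.imK ^ 2 ≤ (τ / 8) ^ 2 := sq_le_sq' h7 h8
    have hn0 : 0 ≤ ‖x‖ := norm_nonneg x
    have hnx : 1 / 2 ≤ ‖x‖ := by nlinarith
    have hx0 : x ≠ 0 := by
      intro h; rw [h, norm_zero] at hnx; linarith
    have hfd2 : fd (quatToSU2 x) 1 ^ 2 = 4 - 2 * (2 * (‖x‖⁻¹ * x.re)) := by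
      rw [fd_one, frobNorm_sub_one_sq, trace_quatToSU2_re hx0]
    -- `‖x‖ − re x ≤ 3τ²/64`
    have hgap : ‖x‖ - x.re ≤ 3 * τ ^ 2 / 64 := by
      have h : (‖x‖ - x.re) * (‖x‖ + x.re) ≤ 3 * (τ / 8) ^ 2 := by nlinarith
      have hpos : 1 ≤ ‖x‖ + x.re := by linarith
      have := (le_div_iff₀ (by linarith : (0 : ℝ) < ‖x‖ + x.re)).2 h
      calc ‖x‖ - x.re ≤ 3 * (τ / 8) ^ 2 / (‖x‖ + x.re) := this
        _ ≤ 3 * (τ / 8) ^ 2 / 1 := div_le_div_of_nonneg_left (by positivity) one_pos hpos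
        _ = 3 * τ ^ 2 / 64 := by ring
    have hfd2' : fd (quatToSU2 x) 1 ^ 2 ≤ τ ^ 2 := by
      rw [hfd2]
      have e : 4 - 2 * (2 * (‖x‖⁻¹ * x.re)) = 4 * ((‖x‖ - x.re) / ‖x‖) := by field_simp; ring
      rw [e]
      have : (‖x‖ - x.re) / ‖x‖ ≤ (3 * τ ^ 2 / 64) / (1 / 2) := by
        exact div_le_div₀ (by positivity) hgap (by norm_num) hnx
      nlinarith
    have h0 : 0 ≤ fd (quatToSU2 x) 1 := frobNorm_nonneg _
    nlinarith
  calc ENNReal.ofReal (ToronLog.coneConst * (τ ^ 3 / 256))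
      = ToronLog.coneMeasure (ToronLog.quatBox lo hi) := by
        rw [ToronLog.coneMeasure_apply (ToronLog.measurableSet_quatBox lo hi) hbox_ball, ToronLog.volume_quatBox,
          ToronLog.inv_volume_ball_eq, ← ENNReal.ofReal_mul ToronLog.coneConst_pos.le]
        · congr 1
          simp only [hlo, hhi, Matrix.cons_val_zero, Matrix.cons_val_one, Matrix.cons_val]
          ring
        · intro i
          fin_cases i <;> simp [hlo, hhi] <;> linarith
    _ ≤ ToronLog.coneMeasure (quatToSU2 ⁻¹' {u : SU2 | fd u 1 ≤ τ}) := measure_mono hproj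
    _ = fdBallMass τ := by
        rw [fdBallMass, ← ToronLog.measurePreserving_quatToSU2.measure_preimage (measurableSet_fdBall 1 τ).nullMeasurableSet]


/-! ## §2 The wrap indices and the four letters of a tree-gauged ring history -/

omit [NeZero L] in
/-- The wrap link of direction `k` is NOT a tree link (its `k`-coordinate is `−1`). [cite: SeilerLNP1982, §2] -/
theorem not_treeEdge_wrapEdge (k : Fin 3) : ¬ treeEdge (wrapEdge (L := L) k) = true := by
  rw [treeEdge_iff]
  fin_cases k <;> simp [wrapEdge, mk3]

/-- The wrap link of direction `k` as an off-tree index. [cite: SeilerLNP1982, §2] -/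
def wrapIdx (k : Fin 3) : OffIdx L := ⟨wrapEdge k, not_treeEdge_wrapEdge k⟩

omit [NeZero L] in
/-- The direction of the wrap link. [folklore] -/
theorem wrapEdge_snd (k : Fin 3) : (wrapEdge (L := L) k).2 = k := by
  fin_cases k <;> rfl

omit [NeZero L] in
/-- The three wrap indices are distinct. [folklore] -/
theorem wrapIdx_injective : Function.Injective (wrapIdx (L := L)) := by
  intro k k' h
  have h' := congrArg (fun e : OffIdx L => e.1.2) h
  simpa only [wrapIdx, wrapEdge_snd] using h'

/-- The tree-gauged ring space `X_fix` (as in ✓`TreeGaugeTransfer`). [cite: Bredon1972, Ch. II §4] -/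
abbrev FixSp (L : ℕ) [NeZero L] : Type :=
  (OffIdx L → SU2) × ((Fin (2 * L - 1) → GaugeConfig 3 L SU2) × (Site 3 L → SU2))

/-- The three wrap letters `h_k = w(wrapEdge k)` of a point of `X_fix`. [cite: Luscher1983, §2] -/
def wrapLetters (x : FixSp L) : Fin 3 → SU2 := fun k => x.1 (wrapIdx k)

/-- The four letters: the three wrap letters and the seam value at the origin. [cite: Luscher1983, §2] -/
def letters (x : FixSp L) : Fin 4 → SU2 := Fin.snoc (wrapLetters x) (x.2.2 0)

/-- `letters` is measurable. [folklore] -/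
theorem measurable_letters : Measurable (letters (L := L)) := by
  refine measurable_pi_iff.2 fun μ => ?_
  refine Fin.lastCases ?_ (fun k => ?_) μ
  · simp only [letters, Fin.snoc_last]
    exact (measurable_pi_apply 0).comp (measurable_snd.comp measurable_snd)
  · simp only [letters, Fin.snoc_castSucc, wrapLetters]
    exact (measurable_pi_apply _).comp measurable_fst

/-! ## §3 The toron event -/

/-- **THE TORON EVENT** at commutator tolerance `t` and chordal radius `τ`: letters pairwise almost commuting, slice `0` (off-tree links) and the
slices `1…2L−1` within `τ` of the comb-flat pattern of the wrap letters, the seam field within `τ` of its value at the origin.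
[cite: Luscher1983, §2] [cite: Vanbaal2001] -/
def toronEvent (t τ : ℝ) : Set (FixSp L) :=
  {x | letters x ∈ ToronLog.nearlyCommuting t ∧ (∀ e : OffIdx L, fd (x.1 e) (combFlat (wrapLetters x) e.1) ≤ τ) ∧
    (∀ (i : Fin (2 * L - 1)) (e : Edge 3 L), fd (x.2.1 i e) (combFlat (wrapLetters x) e) ≤ τ) ∧
    ∀ y : Site 3 L, fd (x.2.2 y) (x.2.2 0) ≤ τ}

/-- The comb-flat pattern of the wrap letters at a link, as a measurable function of the point. [folklore] -/
theorem measurable_combFlat_wrapLetters (e : Edge 3 L) : Measurable fun x : FixSp L => combFlat (wrapLetters x) e := by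
  by_cases he : e.1 e.2 = -1
  · simp only [combFlat_apply, he, if_true, wrapLetters]
    exact (measurable_pi_apply _).comp measurable_fst
  · simp only [combFlat_apply, he, if_false]
    exact measurable_const

/-- The toron event is measurable. [folklore] -/
theorem measurableSet_toronEvent (t τ : ℝ) : MeasurableSet (toronEvent (L := L) t τ) := by
  have hfd : ∀ {f g : FixSp L → SU2}, Measurable f → Measurable g → MeasurableSet {x : FixSp L | fd (f x) (g x) ≤ τ} :=
    fun hf hg => measurableSet_fd_le hf hg τ
  have h1 : MeasurableSet (letters ⁻¹' ToronLog.nearlyCommuting t : Set (FixSp L)) :=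
    measurable_letters (ToronLog.measurableSet_nearlyCommuting t)
  have h2 : MeasurableSet {x : FixSp L | ∀ e : OffIdx L, fd (x.1 e) (combFlat (wrapLetters x) e.1) ≤ τ} := by
    rw [Set.setOf_forall]
    exact MeasurableSet.iInter fun e => hfd ((measurable_pi_apply e).comp measurable_fst) (measurable_combFlat_wrapLetters e.1)
  have h3 : MeasurableSet {x : FixSp L | ∀ (i : Fin (2 * L - 1)) (e : Edge 3 L), fd (x.2.1 i e) (combFlat (wrapLetters x) e) ≤ τ} := by
    rw [Set.setOf_forall]
    refine MeasurableSet.iInter fun i => ?_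
    rw [Set.setOf_forall]
    exact MeasurableSet.iInter fun e =>
      hfd ((measurable_pi_apply e).comp ((measurable_pi_apply i).comp (measurable_fst.comp measurable_snd)))
        (measurable_combFlat_wrapLetters e)
  have h4 : MeasurableSet {x : FixSp L | ∀ y : Site 3 L, fd (x.2.2 y) (x.2.2 0) ≤ τ} := by
    rw [Set.setOf_forall]
    exact MeasurableSet.iInter fun y =>
      hfd ((measurable_pi_apply y).comp (measurable_snd.comp measurable_snd))
        ((measurable_pi_apply 0).comp (measurable_snd.comp measurable_snd))
  have e : toronEvent (L := L) t τ = (letters ⁻¹' ToronLog.nearlyCommuting t : Set (FixSp L)) ∩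
      ({x : FixSp L | ∀ e : OffIdx L, fd (x.1 e) (combFlat (wrapLetters x) e.1) ≤ τ} ∩
      ({x : FixSp L | ∀ (i : Fin (2 * L - 1)) (e : Edge 3 L), fd (x.2.1 i e) (combFlat (wrapLetters x) e) ≤ τ} ∩
        {x : FixSp L | ∀ y : Site 3 L, fd (x.2.2 y) (x.2.2 0) ≤ τ})) := by
    ext x; simp only [toronEvent, Set.mem_setOf_eq, Set.mem_inter_iff, Set.mem_preimage]
  rw [e]
  exact h1.inter (h2.inter (h3.inter h4))

/-! ## §4 The product-Haar mass of the toron event -/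

/-- A product of chordal balls has product-Haar mass `b(τ)^{#coordinates}`. [folklore] -/
theorem pi_haar_fdBalls {ι : Type} [Fintype ι] (c : ι → SU2) (τ : ℝ) :
    (Measure.pi fun _ : ι => haarProbability SU2) {f : ι → SU2 | ∀ i, fd (f i) (c i) ≤ τ} = fdBallMass τ ^ Fintype.card ι := by
  have e : {f : ι → SU2 | ∀ i, fd (f i) (c i) ≤ τ} = Set.pi Set.univ fun i => {u : SU2 | fd u (c i) ≤ τ} := by
    ext f; simp
  rw [e, Measure.pi_pi]
  simp only [haar_fdBall_eq, Finset.prod_const, Finset.card_univ]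

/-- The slices `1…2L−1` in a product of chordal balls: mass `(b(τ)^{|E|})^{2L−1}`. [folklore] -/
theorem pi_config_fdBalls (c : Edge 3 L → SU2) (τ : ℝ) :
    (Measure.pi fun _ : Fin (2 * L - 1) => configMeasure SU2 L)
        {U : Fin (2 * L - 1) → GaugeConfig 3 L SU2 | ∀ i e, fd (U i e) (c e) ≤ τ} =
      (fdBallMass τ ^ Fintype.card (Edge 3 L)) ^ (2 * L - 1) := by
  have e : {U : Fin (2 * L - 1) → GaugeConfig 3 L SU2 | ∀ i e, fd (U i e) (c e) ≤ τ} =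
      Set.pi Set.univ fun _ => {V : GaugeConfig 3 L SU2 | ∀ e, fd (V e) (c e) ≤ τ} := by
    ext U; simp
  rw [e, Measure.pi_pi]
  simp only [configMeasure, pi_haar_fdBalls, Finset.prod_const, Finset.card_univ, Fintype.card_fin]

/-- The seam field: the origin letter free in a set `A`, every other value in the chordal ball around it — mass `b(τ)^{|sites|−1} · Haar(A)`.
[folklore] -/
theorem gaugeMeasure_seam {A : Set SU2} (hA : MeasurableSet A) {τ : ℝ} (hτ : 0 ≤ τ) :
    gaugeMeasure L {g : Site 3 L → SU2 | g 0 ∈ A ∧ ∀ y, fd (g y) (g 0) ≤ τ} =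
      fdBallMass τ ^ Fintype.card {y : Site 3 L // ¬ y = 0} * haarProbability SU2 A := by
  classical
  haveI : Unique {y : Site 3 L // y = 0} := ⟨⟨⟨0, rfl⟩⟩, fun y => Subtype.ext y.2⟩
  set es := MeasurableEquiv.piEquivPiSubtypeProd (fun _ : Site 3 L => SU2) (fun y => y = 0) with hes
  have hpres := measurePreserving_piEquivPiSubtypeProd (fun _ : Site 3 L => haarProbability SU2) (fun y => y = 0)
  -- the event in split coordinates
  set S : Set (({y : Site 3 L // y = 0} → SU2) × ({y : Site 3 L // ¬ y = 0} → SU2)) :=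
    {p | p.1 ⟨0, rfl⟩ ∈ A ∧ ∀ y, fd (p.2 y) (p.1 ⟨0, rfl⟩) ≤ τ} with hS
  have hSmeas : MeasurableSet S := by
    have h1 : MeasurableSet ((fun p : ({y : Site 3 L // y = 0} → SU2) × ({y : Site 3 L // ¬ y = 0} → SU2) => p.1 ⟨0, rfl⟩) ⁻¹' A) :=
      ((measurable_pi_apply _).comp measurable_fst) hA
    have h2 : MeasurableSet {p : ({y : Site 3 L // y = 0} → SU2) × ({y : Site 3 L // ¬ y = 0} → SU2) |
        ∀ y, fd (p.2 y) (p.1 ⟨0, rfl⟩) ≤ τ} := by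
      rw [Set.setOf_forall]
      exact MeasurableSet.iInter fun y =>
        measurableSet_fd_le ((measurable_pi_apply y).comp measurable_snd) ((measurable_pi_apply _).comp measurable_fst) τ
    have e : S = ((fun p : ({y : Site 3 L // y = 0} → SU2) × ({y : Site 3 L // ¬ y = 0} → SU2) => p.1 ⟨0, rfl⟩) ⁻¹' A) ∩
        {p | ∀ y, fd (p.2 y) (p.1 ⟨0, rfl⟩) ≤ τ} := by
      ext p; simp only [hS, Set.mem_setOf_eq, Set.mem_inter_iff, Set.mem_preimage]
    rw [e]; exact h1.inter h2
  have hpre : {g : Site 3 L → SU2 | g 0 ∈ A ∧ ∀ y, fd (g y) (g 0) ≤ τ} = es ⁻¹' S := by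
    ext g
    simp only [hS, hes, Set.mem_setOf_eq, Set.mem_preimage, MeasurableEquiv.piEquivPiSubtypeProd_apply]
    constructor
    · rintro ⟨h0, h⟩; exact ⟨h0, fun y => h y.1⟩
    · rintro ⟨h0, h⟩
      refine ⟨h0, fun y => ?_⟩
      by_cases hy : y = 0
      · subst hy; rw [fd_self]; exact hτ
      · exact h ⟨y, hy⟩
  rw [hpre, show gaugeMeasure L = Measure.pi (fun _ : Site 3 L => haarProbability SU2) from rfl,
    hpres.measure_preimage hSmeas.nullMeasurableSet, Measure.prod_apply hSmeas]
  -- sections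
  have hsec : ∀ a : {y : Site 3 L // y = 0} → SU2,
      (Measure.pi fun _ : {y : Site 3 L // ¬ y = 0} => haarProbability SU2) (Prod.mk a ⁻¹' S) =
        A.indicator (fun _ => fdBallMass τ ^ Fintype.card {y : Site 3 L // ¬ y = 0}) (a ⟨0, rfl⟩) := by
    intro a
    by_cases ha : a ⟨0, rfl⟩ ∈ A
    · rw [Set.indicator_of_mem ha]
      have e : Prod.mk a ⁻¹' S = {b : {y : Site 3 L // ¬ y = 0} → SU2 | ∀ y, fd (b y) (a ⟨0, rfl⟩) ≤ τ} := by
        ext b; simp [hS, ha]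
      rw [e, pi_haar_fdBalls]
    · rw [Set.indicator_of_notMem ha]
      have e : Prod.mk a ⁻¹' S = ∅ := by ext b; simp [hS, ha]
      rw [e, measure_empty]
  simp_rw [hsec]
  set K : ℝ≥0∞ := fdBallMass τ ^ Fintype.card {y : Site 3 L // ¬ y = 0} with hK
  have hφ : Measurable fun a : {y : Site 3 L // y = 0} → SU2 => a ⟨0, rfl⟩ := measurable_pi_apply _
  have e1 : (fun a : {y : Site 3 L // y = 0} → SU2 => A.indicator (fun _ => K) (a ⟨0, rfl⟩)) =
      ((fun a : {y : Site 3 L // y = 0} → SU2 => a ⟨0, rfl⟩) ⁻¹' A).indicator fun _ => K := by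
    funext a
    simp only [Set.indicator_apply, Set.mem_preimage]
  rw [e1, lintegral_indicator_const (hφ hA)]
  congr 1
  -- the one-coordinate product measure is Haar measure
  have e2 : (fun a : {y : Site 3 L // y = 0} → SU2 => a ⟨0, rfl⟩) ⁻¹' A = Set.pi Set.univ fun _ => A := by
    ext a
    simp only [Set.mem_preimage, Set.mem_univ_pi]
    constructor
    · intro h y; rwa [Subsingleton.elim y ⟨0, rfl⟩]
    · intro h; exact h _
  rw [e2, Measure.pi_pi, Fintype.prod_unique]

end Summit.QuantumFields.YangMills.Theorems.SwapTwistDeficit.ToronFloor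

end
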